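import Summits.QuantumFields.YangMills.Theses.CoincidenceRotationBootstrap
import Summits.QuantumFields.YangMills.Theses.ScalingWindowSplit
import Literature.MathematicalPhysics.QuantumFieldTheory.SchwingerLimitInheritance
import HarnessLib.Audit

/-!
# Birth skeleton (BC3) for crux `CurvatureAmnesia` (item stmt-QuantumFields-16192) — `Lines/birth.lean`

Route `CoincidenceRotationBootstrap` (sub-problem YangMills; the crux is SHARED verbatim with route
`ScalingWindowSplit`, rank 4 there), crux decl
`Summit.QuantumFields.YangMills.Theses.CoincidenceRotationBootstrap.CurvatureAmnesia` (ORIENTATION AMNESIA):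
for every compact simple `G`, faithful lattice representation `r`, sequential scheme `sch` at weak coupling
and labelled Schwinger family `S` on `ℝ⁴` carrying the OS/translation/proper-hypercubic guards, the lattice
TIE (joint limit of the renormalised Wilson correlations along `sch` on off-diagonal real tensors),
non-triviality of the curvature species and the two mass gaps, the curvature-species Schwinger functions are
invariant on `⁰𝒮` under the Σ5 rotation `R` (`cos θ = 3/5`, `sin θ = 4/5` in the `(x₂,x₃)` plane).

Registered by the skeleton-registrar seat `planner-skel-stmt-QuantumFields-16192-0` (route re-audit bin
REPAIRABLE, 2026-08-17) as `Cruxes/CurvatureAmnesia/Lines/birth.lean`.  LINE-NEUTRAL cut along the seam the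
route header itself names ("Intended engine (layer 2): one-step commensurate self-comparison on
Λ = (2+i)ℤ[i]×ℤ²" — a LATTICE statement) and the one functional-analytic fact every such engine needs to
reach `⁰𝒮`:

* `stub_latticeSigmaFiveBlindness : LatticeSigmaFiveBlindness` (THE HARD STUB, open-problem; the crux's
  LATTICE AVATAR).  Under the crux's hypotheses VERBATIM (`hW`, guards, tie, non-triviality, gaps), for the
  Σ5 rotation `R`, every arity `n` and every SEPARATED real family `f` (compact, pairwise disjoint supports):
  the renormalised Wilson curvature correlators smeared against `f ∘ R⁻¹` and against `f` have the same
  asymptotics, `⟨∏ᵢ Φ_k(fᵢ ∘ R⁻¹)⟩_k − ⟨∏ᵢ Φ_k(fᵢ)⟩_k → 0` (`latticeSchwinger … (linActTest R ∘ f) −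
  latticeSchwinger … f → 0`).  Unfolding `smearedLatticeField`, `Φ_k(f ∘ R⁻¹)` is the curvature of the SAME
  Wilson measure read on the ROTATED lattice `R⁻¹ℤ⁴a_k`: the stub compares Wilson's theory on `ℤ⁴a_k` with its
  own image on `Rℤ⁴a_k` at the same `(β_k, a_k)` — exactly the object of the Σ5 coincidence engine
  (`ℤ⁴ ∩ Rℤ⁴ = Λ` of index 5; the proper involution `g = R∘σ₃σ₀ ∈ SO(4)` swaps the two parent lattices and
  fixes `Λ`), with the observables localised in pairwise disjoint compact regions at physical separation
  (what a block / cluster comparison consumes).  No value of `S` off the lattice-tied tensors is mentioned.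
  TRANSFER, not strengthening: `CurvatureAmnesia → LatticeSigmaFiveBlindness` is PROVED below
  (`latticeSigmaFiveBlindness_of_curvatureAmnesia`, from the tie alone), and
  `LatticeSigmaFiveBlindness → SeparatedTensorsTotal → CurvatureAmnesia` is the composition; so any
  counterexample to the stub refutes the crux itself.  Why it might fail = the crux's own: non-perturbative
  `(a/ℓ)²`-irrelevance of the `W(B₄)`-scalar dimension-6 `O(4)`-breaking operators (Weisz 1983,
  Lüscher–Weisz 1985) along weak-coupling Wilson schemes is unproved — no small parameter but `(a/ℓ)²`.
* `stub_separatedTensorsTotal : SeparatedTensorsTotal` (functional analysis, size L, provable in kind) — two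
  continuous linear functionals on `𝓢((ℝ⁴)ⁿ, ℂ)` that agree on the complexified real tensors with compactly
  supported, pairwise disjoint factors agree on all of `⁰𝒮ₙ` (`IsOffDiagonal`: flat on the coincidence
  locus).  Why plausibly true: `C_c^∞` of the complement of the coincidence locus `D` is `𝓢`-dense in the
  functions flat on `D` (truncation at infinity, then Whitney's spectral theorem / the cut-off
  `∏_{i<j}(1 − χ((x_i−x_j)/ε))` with Taylor flatness; OS 1973 §2, KQR 2021 Rem. 2.4), and `C_c^∞((ℝ⁴)ⁿ ∖ D)`
  is spanned in the `C^∞` topology by tensors with separated factors (partition of unity into separated box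
  products, `C^∞`-density of tensors on a product of boxes; complex factors expand into `2ⁿ` real tensors);
  `n = 0`: the empty tensor is the constant `1`, which spans `𝓢(pt)`; `n = 1`: `D = ∅`, `C_c^∞` is dense in
  `𝓢`.  Same statement as the registered `SeparatedTensorsTotal` of the QCD crux `RotationRestoration`
  (`Cruxes/RotationRestoration/Lines/birth.lean`, 2026-08-17) — one proof serves both.

`CurvatureAmnesia_of : LatticeSigmaFiveBlindness → SeparatedTensorsTotal → CurvatureAmnesia` (hypotheses keyed
by the registered stub names through the `Registered.stub_*` aliases; conclusion the route decl BY NAME) is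
kernel-checked with no `sorry` outside `stub_*`: totality (S2) reduces the claim to separated real tensors
`F = ⊗ fᵢ`; those are off-diagonal (`IsSeparated.isOffDiagonal`), so the TIE gives convergence of the
lattice correlators at `f` to `S n (F)` and — `linActMulti R F` being the tensor of the `fᵢ ∘ R⁻¹`
(`IsTensorOf.linActMulti`) and again off-diagonal (`isOffDiagonal_linActMulti`) — at `f ∘ R⁻¹` to
`S n (linActMulti R F)`; the stub (S1) says the difference of the two real sequences tends to `0`, hence the
two complex limits agree (`limit_eq_of_sub_tendsto_zero`); `n = 0` is the identity `linActMulti R F = F`.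
`CurvatureAmnesia_skeleton` instantiates it with the stubs; `CurvatureAmnesia_proof_scalingWindowSplit` /
`CurvatureAmnesia_of_scalingWindowSplit` serve the verbatim copy `ScalingWindowSplit.CurvatureAmnesia`.

## Negative knowledge honoured
* `ledger crux ls stmt-QuantumFields-16192`: no workfiles before this one (no `Disproof.lean`, no dead lines).
* `ledger negatives --problem QuantumFields` (5 entries, 2026-08-17): the only rotation-adjacent one is
  `MirrorModularBoosts.DiagonalMirrorRP` (reflection positivity in a diagonal mirror — refuted); no stub here
  asserts reflection positivity in any frame or any property of `S` beyond the crux's own hypotheses.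
* The Yang–Mills disprover's model-blind junk for `NPointIsotropy` (`Theorems/NPointIsotropy/Negative/*`:
  `PlanarGenericJunk` — planar-generic supports do NOT determine a functional on `⁰𝒮`; `ModelBlindFalse`,
  `TieLoadBearing`) is respected: (S1) keeps the Wilson TIE and every guard of the crux as hypotheses, and
  (S2) uses SEPARATED tensors flat near the whole coincidence locus (the benign class), never planar-generic
  supports.
* Route why-might-fail ("the guards alone never force Σ5-blindness", e1-counterexample-zoo): (S1) is not a
  guards-only statement — its conclusion is about the Wilson lattice correlators themselves.

## BC3 probes (planner folder `bc/`): for each stub statement `X`, `X → CurvatureAmnesia` and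
`X → YangMills` by `first | exact? | simpa | aesop` FAIL (files `bc/birth_probe_*.lean`, outputs in NOTES.md).
-/

noncomputable section

-- Mathlib's `SimplexCategory` instance `Fintype (Fin (x.len + 1))` matches `Fintype (Fin 4)` (tree-known
-- workaround, as in `Cruxes/RotationRestoration/Lines/birth.lean`).
attribute [-instance] SimplexCategory.instFintypeToTypeOrderHomFinHAddNatLenOfNat

namespace Summit.QuantumFields.YangMills.Cruxes.CurvatureAmnesia.Birth

open scoped BigOperators Topology SchwartzMap
open Filter
open Literature.MathematicalPhysics.QuantumLattice Literature.MathematicalPhysics.AQFT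
  Literature.MathematicalPhysics.QuantumFieldTheory
open Summit.QuantumFields.YangMills.Theses.CoincidenceRotationBootstrap (CurvatureAmnesia)

/-- `ℝ⁴` (file-local notation). -/
local notation "E4" => EuclideanSpace ℝ (Fin 4)

/-! ## §0 Vocabulary (verbatim clauses of the crux) -/

/-- The Σ5 rotation clause of the crux (verbatim): `R e₀ = e₀`, `R e₁ = e₁`, `R e₂ = (3e₂+4e₃)/5`,
`R e₃ = (−4e₂+3e₃)/5`. -/
def IsSigmaFive (R : E4 ≃ₗᵢ[ℝ] E4) : Prop :=
  R (EuclideanSpace.single 0 1) = EuclideanSpace.single 0 1 ∧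
    R (EuclideanSpace.single 1 1) = EuclideanSpace.single 1 1 ∧
      R (EuclideanSpace.single 2 1) =
          (3/5 : ℝ) • EuclideanSpace.single 2 1 + (4/5 : ℝ) • EuclideanSpace.single 3 1 ∧
        R (EuclideanSpace.single 3 1) =
          -((4/5 : ℝ) • EuclideanSpace.single 2 1) + (3/5 : ℝ) • EuclideanSpace.single 3 1

section Guards

variable {ι : Type}

/-- The guard package of the crux (its second hypothesis, verbatim): E0 (normalisation, hermiticity), E0',
E2, E3, E4, translation invariance and proper-hypercubic invariance on `⁰𝒮`. -/
def Guards (S : LabelledSchwingerFamily ι E4) : Prop :=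
  S.IsNormalized ∧ S.IsHermitian ∧ S.HasLinearGrowth ∧ S.IsReflectionPositive ∧ S.IsSymmetric ∧
    S.HasClusterProperty ∧
    (∀ (n : ℕ) (k : Fin n → ι) (a : E4) (F : 𝓢((Fin n → E4), ℂ)), IsOffDiagonal F →
      S n k (translateMulti a F) = S n k F) ∧
    (∀ (n : ℕ) (k : Fin n → ι) (R : E4 ≃ₗᵢ[ℝ] E4), LinearMap.det (R.toLinearEquiv : E4 →ₗ[ℝ] E4) = 1 →
      (∀ i : Fin 4, ∃ j : Fin 4, R (EuclideanSpace.single i 1) = EuclideanSpace.single j 1 ∨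
        R (EuclideanSpace.single i 1) = -EuclideanSpace.single j 1) →
      ∀ F : 𝓢((Fin n → E4), ℂ), IsOffDiagonal F → S n k (linActMulti R F) = S n k F)

end Guards

section Lattice

variable {G : Type} [Group G] [TopologicalSpace G] [IsTopologicalGroup G] [CompactSpace G]
  [MeasurableSpace G] [BorelSpace G]

/-- The lattice TIE of the crux (its third hypothesis, verbatim = the body of `IsYangMillsFor`): `S` is the
`k → ∞` limit of the renormalised joint Wilson lattice `n`-point functions along `sch` on off-diagonal real
tensors, `n ≠ 0`. -/
def IsLatticeLimit (r : LatticeRep G) (sch : SpeciesScheme (YMSpecies G))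
    (S : LabelledSchwingerFamily (YMSpecies G) E4) : Prop :=
  ∀ (n : ℕ), n ≠ 0 → ∀ (σ : Fin n → YMSpecies G) (f : Fin n → 𝓢(E4, ℝ)) (F : 𝓢((Fin n → E4), ℂ)),
    IsTensorOf F (fun i => ofRealTest (f i)) → IsOffDiagonal F →
      Tendsto (fun k : ℕ => ((latticeSchwinger r.ρ sch (fun s => s.F) k n σ f : ℝ) : ℂ)) atTop
        (𝓝 (S n σ F))

/-- Non-triviality of the curvature species (the crux's fourth hypothesis, verbatim). -/
def CurvatureNontrivial (r : LatticeRep G) (S : LabelledSchwingerFamily (YMSpecies G) E4) : Prop :=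
  ∃ (F₁ G₁ : 𝓢((Fin 1 → E4), ℂ)) (H₁ : 𝓢((Fin (1 + 1) → E4), ℂ)),
    IsTimeOrdered F₁ ∧ IsTimeOrdered G₁ ∧ IsAppendTensorOf H₁ (osAdjoint F₁) G₁ ∧
      S (1 + 1) (fun _ => r.curvature) H₁ ≠
        S 1 (fun _ => r.curvature) (osAdjoint F₁) * S 1 (fun _ => r.curvature) G₁

/-- Continuum and volume-uniform lattice mass gaps (the crux's fifth hypothesis, verbatim). -/
def HasGaps (r : LatticeRep G) (sch : SpeciesScheme (YMSpecies G))
    (S : LabelledSchwingerFamily (YMSpecies G) E4) : Prop :=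
  ∃ Δ : ℝ, 0 < Δ ∧ S.HasMassGap Δ ∧ HasLatticeMassGap r sch Δ

end Lattice

/-- A SEPARATED family of real one-point test functions: compactly supported, pairwise disjoint supports
(so every tensor `f₁ ⊗ ⋯ ⊗ fₙ` vanishes near the coincidence locus, `IsSeparated.isOffDiagonal`). -/
def IsSeparated {n : ℕ} (f : Fin n → 𝓢(E4, ℝ)) : Prop :=
  (∀ i, HasCompactSupport (f i : E4 → ℝ)) ∧
    ∀ i j, i ≠ j → Disjoint (tsupport (f i : E4 → ℝ)) (tsupport (f j : E4 → ℝ))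

/-! ## §1 The two stub statements -/

/-- **(S1) Lattice orientation amnesia on separated real tensors** (THE hard stub; open-problem; the crux's
lattice avatar).  Under the crux's hypotheses verbatim, for the Σ5 rotation `R`, every arity `n` and every
separated real family `f`, the renormalised Wilson curvature correlators along `sch` smeared against
`fᵢ ∘ R⁻¹` and against `fᵢ` have vanishing difference as `k → ∞`.  `Φ_k(f ∘ R⁻¹)(U) =
c_k a_k⁴ ∑_{y ∈ R⁻¹ℤ⁴} f(a_k y)(O(τ_{Ry}U) − m_k)`: the theory on `ℤ⁴a_k` against its own image on the
rotated parent lattice, at the same `(β_k, a_k)`, through the common index-5 sublattice `Λ`. -/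
def LatticeSigmaFiveBlindness : Prop :=
  ∀ (G : Type) [Group G] [TopologicalSpace G] [IsTopologicalGroup G] [CompactSpace G],
    IsCompactSimpleLieGroup G →
      letI : MeasurableSpace G := borel G
      haveI : BorelSpace G := ⟨rfl⟩
      ∀ (r : LatticeRep G) (sch : SpeciesScheme (YMSpecies G))
        (S : LabelledSchwingerFamily (YMSpecies G) E4),
        sch.HasWeakCouplingLimit → Guards S → IsLatticeLimit r sch S → CurvatureNontrivial r S →
          HasGaps r sch S →
            ∀ R : E4 ≃ₗᵢ[ℝ] E4, IsSigmaFive R →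
              ∀ (n : ℕ) (f : Fin n → 𝓢(E4, ℝ)), IsSeparated f →
                Tendsto (fun k : ℕ =>
                    latticeSchwinger r.ρ sch (fun s => s.F) k n (fun _ => r.curvature)
                        (fun i => linActTest R (f i)) -
                      latticeSchwinger r.ρ sch (fun s => s.F) k n (fun _ => r.curvature) f)
                  atTop (𝓝 0)

/-- **(S2) Separated real tensors are total in `⁰𝒮`** (functional analysis; size L).  Two continuous linear
functionals on `𝓢((ℝ⁴)ⁿ, ℂ)` agreeing on the complexified real tensors with compactly supported, pairwise
disjoint factors agree on every test function flat on the coincidence locus (`IsOffDiagonal`). -/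
def SeparatedTensorsTotal : Prop :=
  ∀ (n : ℕ) (T₁ T₂ : 𝓢((Fin n → E4), ℂ) →L[ℂ] ℂ),
    (∀ f : Fin n → 𝓢(E4, ℝ), IsSeparated f →
      ∀ F : 𝓢((Fin n → E4), ℂ), IsTensorOf F (fun i => ofRealTest (f i)) → T₁ F = T₂ F) →
      ∀ F : 𝓢((Fin n → E4), ℂ), IsOffDiagonal F → T₁ F = T₂ F

/-! ## §2 The registered stubs (the ONLY `sorry`s of this file) -/

/-- (S1) lattice orientation amnesia on separated real tensors — the hard stub (open-problem). -/
theorem stub_latticeSigmaFiveBlindness : LatticeSigmaFiveBlindness := by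
  sorry

/-- (S2) separated real tensors are total in `⁰𝒮` — size L. -/
theorem stub_separatedTensorsTotal : SeparatedTensorsTotal := by
  sorry

/-! ### Name-keyed aliases of the two statements (hypotheses of the composition)

`Registered.stub_X` is statement `X` under the registered stub's short name, so that the native skeleton
audit (hypotheses admissible iff registered obligations / declared stubs BY NAME) accepts
`CurvatureAmnesia_of : Registered.stub_latticeSigmaFiveBlindness → … → CurvatureAmnesia` (device of
`Cruxes/RotationRestoration/Lines/birth.lean`). -/
namespace Registered

/-- Alias of `LatticeSigmaFiveBlindness` keyed by the registered stub name. -/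
abbrev stub_latticeSigmaFiveBlindness : Prop := LatticeSigmaFiveBlindness
/-- Alias of `SeparatedTensorsTotal` keyed by the registered stub name. -/
abbrev stub_separatedTensorsTotal : Prop := SeparatedTensorsTotal

end Registered

/-! ## §3 Composition (kernel-checked; no `sorry` below this line) -/

section Action

variable {E : Type*} [NormedAddCommGroup E] [NormedSpace ℝ E] {n : ℕ}

/-- `⁰𝒮` is stable under the diagonal action of a linear isometry (a linear change of variables preserving
the diagonals; `IsOffDiagonal.precomp`). [folklore] -/
theorem isOffDiagonal_linActMulti (A : E ≃ₗᵢ[ℝ] E) {F : 𝓢((Fin n → E), ℂ)} (hF : IsOffDiagonal F) :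
    IsOffDiagonal (linActMulti A F) :=
  hF.precomp
    (ContinuousLinearEquiv.piCongrRight fun _ : Fin n => A.symm.toContinuousLinearEquiv)
    (fun x hx => by
      obtain ⟨i, j, hij, hxij⟩ := hx
      exact ⟨i, j, hij, by simp [hxij]⟩)
    (fun _ => rfl)

/-- With no points there is nothing to rotate: `linActMulti A F = F` on `𝓢((Fin 0 → E), ℂ)`. [folklore] -/
theorem linActMulti_eq_self_of_isEmpty [IsEmpty (Fin n)] (A : E ≃ₗᵢ[ℝ] E) (F : 𝓢((Fin n → E), ℂ)) :
    linActMulti A F = F := by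
  ext x
  simp only [linActMulti_apply]
  congr 1
  funext i
  exact isEmptyElim i

end Action

/-- **Separated real tensors are off-diagonal**: the topological support of `⊗ fᵢ` lies in
`∏ tsupport fᵢ`, which misses the coincidence locus when the supports are pairwise disjoint. [folklore] -/
theorem IsSeparated.isOffDiagonal {n : ℕ} {f : Fin n → 𝓢(E4, ℝ)} (hf : IsSeparated f)
    {F : 𝓢((Fin n → E4), ℂ)} (hF : IsTensorOf F fun i => ofRealTest (f i)) : IsOffDiagonal F := by
  -- `tsupport F = closure (support F) ⊆ ⋂ᵢ evalᵢ⁻¹(tsupport fᵢ)` (closed, contains `support F`)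
  have hsub : closure (Function.support (F : (Fin n → E4) → ℂ)) ⊆
      ⋂ i, (fun x : Fin n → E4 => x i) ⁻¹' tsupport (f i : E4 → ℝ) :=
    closure_minimal
      (fun y hy => Set.mem_iInter.2 fun i => subset_tsupport _ (by
        rw [Function.mem_support] at hy ⊢
        intro h0
        refine hy ?_
        rw [hF y]
        exact Finset.prod_eq_zero (Finset.mem_univ i)
          (by show ((f i (y i) : ℝ) : ℂ) = 0; rw [h0, Complex.ofReal_zero])))
      (isClosed_iInter fun i => (isClosed_tsupport _).preimage (continuous_apply i))
  refine IsOffDiagonal.of_tsupport_subset ?_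
  intro x hx hxD
  obtain ⟨i, j, hij, hxij⟩ := hxD
  have hi : x i ∈ tsupport (f i : E4 → ℝ) := Set.mem_iInter.1 (hsub hx) i
  have hj : x j ∈ tsupport (f j : E4 → ℝ) := Set.mem_iInter.1 (hsub hx) j
  rw [hxij] at hi
  exact Set.disjoint_left.1 (hf.2 i j hij) hi hj

/-- Two complexified real sequences with limits `a`, `b` whose real difference tends to `0` have `a = b`
(uniqueness of limits in `ℂ`). [folklore] -/
theorem limit_eq_of_sub_tendsto_zero {u v : ℕ → ℝ} {a b : ℂ}
    (hu : Tendsto (fun k => ((u k : ℝ) : ℂ)) atTop (𝓝 a))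
    (hv : Tendsto (fun k => ((v k : ℝ) : ℂ)) atTop (𝓝 b))
    (h0 : Tendsto (fun k => u k - v k) atTop (𝓝 0)) : a = b := by
  have h : Tendsto (fun k => ((u k : ℝ) : ℂ) - ((v k : ℝ) : ℂ)) atTop (𝓝 0) := by
    have h' := (Complex.continuous_ofReal.tendsto 0).comp h0
    rw [Complex.ofReal_zero] at h'
    exact h'.congr fun k => by simp only [Function.comp_apply, Complex.ofReal_sub]
  exact sub_eq_zero.mp (tendsto_nhds_unique (hu.sub hv) h)

/-- **The continuum form of (S1)**: under the crux's hypotheses, Σ5-invariance of the curvature Schwinger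
functions on SEPARATED real tensors.  Derived from the lattice stub through the TIE: both lattice sequences
converge (`linActMulti R F` is the tensor of the rotated factors, again off-diagonal) and their difference
tends to `0`. -/
theorem sigmaFive_apply_eq_of_separated (hL : Registered.stub_latticeSigmaFiveBlindness)
    (G : Type) [Group G] [TopologicalSpace G] [IsTopologicalGroup G] [CompactSpace G]
    (hG : IsCompactSimpleLieGroup G) :
    letI : MeasurableSpace G := borel G
    haveI : BorelSpace G := ⟨rfl⟩
    ∀ (r : LatticeRep G) (sch : SpeciesScheme (YMSpecies G))
      (S : LabelledSchwingerFamily (YMSpecies G) E4),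
      sch.HasWeakCouplingLimit → Guards S → IsLatticeLimit r sch S → CurvatureNontrivial r S →
        HasGaps r sch S →
          ∀ R : E4 ≃ₗᵢ[ℝ] E4, IsSigmaFive R →
            ∀ (n : ℕ) (f : Fin n → 𝓢(E4, ℝ)), IsSeparated f →
              ∀ F : 𝓢((Fin n → E4), ℂ), IsTensorOf F (fun i => ofRealTest (f i)) →
                S n (fun _ => r.curvature) (linActMulti R F) = S n (fun _ => r.curvature) F := by
  letI : MeasurableSpace G := borel G
  haveI : BorelSpace G := ⟨rfl⟩
  intro r sch S hW hax hconv hNT hgap R hR n f hf F hF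
  rcases Nat.eq_zero_or_pos n with rfl | hn
  · rw [linActMulti_eq_self_of_isEmpty]
  · have hod : IsOffDiagonal F := hf.isOffDiagonal hF
    -- the TIE at `f` and at the rotated family `fᵢ ∘ R⁻¹` (whose tensor is `linActMulti R F`)
    have h1 := hconv n hn.ne' (fun _ => r.curvature) f F hF hod
    have h2 := hconv n hn.ne' (fun _ => r.curvature) (fun i => linActTest R (f i)) (linActMulti R F)
      (hF.linActMulti R) (isOffDiagonal_linActMulti R hod)
    -- STUB (S1): the difference of the two real lattice sequences tends to `0`
    have h0 := hL G hG r sch S hW hax hconv hNT hgap R hR n f hf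
    exact limit_eq_of_sub_tendsto_zero h2 h1 h0

/-- **The crux from the two stubs** (concludes `CurvatureAmnesia` BY NAME).  Totality (S2) applied to the
functionals `(S n σ) ∘ linActMulti R` and `S n σ` (σ the all-curvature string) reduces Σ5-invariance on
`⁰𝒮` to separated real tensors, where it is `sigmaFive_apply_eq_of_separated` (stub S1 + the tie). -/
theorem CurvatureAmnesia_of (hL : Registered.stub_latticeSigmaFiveBlindness)
    (hT : Registered.stub_separatedTensorsTotal) : CurvatureAmnesia := by
  intro G _ _ _ _ hG
  letI : MeasurableSpace G := borel G
  haveI : BorelSpace G := ⟨rfl⟩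
  intro r sch S hW hax hconv hNT hgap R hR n F₀ hF₀
  refine hT n ((S n fun _ => r.curvature).comp (linActMulti R)) (S n fun _ => r.curvature) ?_ F₀ hF₀
  intro f hf F hF
  exact sigmaFive_apply_eq_of_separated hL G hG r sch S hW hax hconv hNT hgap R hR n f hf F hF

/-- The crux along this skeleton, from the registered stubs (sorries only inside `stub_*`). -/
theorem CurvatureAmnesia_skeleton : CurvatureAmnesia :=
  CurvatureAmnesia_of stub_latticeSigmaFiveBlindness stub_separatedTensorsTotal

/-! ### The shared crux under its other route name (`ScalingWindowSplit.CurvatureAmnesia`, item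
stmt-QuantumFields-16192 wanted_by both routes; the two route copies are verbatim and definitionally equal). -/

/-- Composition, concluding the copy `ScalingWindowSplit.CurvatureAmnesia` (sorry-free). -/
theorem CurvatureAmnesia_of_scalingWindowSplit (hL : Registered.stub_latticeSigmaFiveBlindness)
    (hT : Registered.stub_separatedTensorsTotal) :
    Summit.QuantumFields.YangMills.Theses.ScalingWindowSplit.CurvatureAmnesia :=
  CurvatureAmnesia_of hL hT

/-- The skeleton under the name `ScalingWindowSplit.CurvatureAmnesia`. -/
theorem CurvatureAmnesia_proof_scalingWindowSplit :
    Summit.QuantumFields.YangMills.Theses.ScalingWindowSplit.CurvatureAmnesia :=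
  CurvatureAmnesia_skeleton

/-! ### (S1) is the crux's lattice avatar, not a strengthening -/

/-- **`CurvatureAmnesia → LatticeSigmaFiveBlindness`** (from the tie alone): Σ5-invariance of `S` on `⁰𝒮`
makes the two lattice sequences of (S1) converge to the same complex number, so their real difference tends
to `0`.  Hence (S1) is EQUIVALENT to the crux modulo the totality fact (S2): a counterexample to (S1)
refutes `CurvatureAmnesia` itself. -/
theorem latticeSigmaFiveBlindness_of_curvatureAmnesia (h : CurvatureAmnesia) :
    LatticeSigmaFiveBlindness := by
  intro G _ _ _ _ hG
  letI : MeasurableSpace G := borel G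
  haveI : BorelSpace G := ⟨rfl⟩
  intro r sch S hW hax hconv hNT hgap R hR n f hf
  rcases Nat.eq_zero_or_pos n with rfl | hn
  · -- no points: both 0-point functions are the total mass of the same Wilson measure
    refine tendsto_const_nhds.congr fun k => ?_
    simp only [latticeSchwinger, Finset.univ_eq_empty, Finset.prod_empty, sub_self]
  · obtain ⟨F, hF⟩ : ∃ F : 𝓢((Fin n → E4), ℂ), IsTensorOf F (fun i => ofRealTest (f i)) :=
      ⟨_, isTensorOf_tensorFin _⟩
    have hod : IsOffDiagonal F := hf.isOffDiagonal hF
    have h1 := hconv n hn.ne' (fun _ => r.curvature) f F hF hod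
    have h2 := hconv n hn.ne' (fun _ => r.curvature) (fun i => linActTest R (f i)) (linActMulti R F)
      (hF.linActMulti R) (isOffDiagonal_linActMulti R hod)
    rw [h G hG r sch S hW hax hconv hNT hgap R hR n F hod] at h2
    have h3 := (Complex.continuous_re.tendsto _).comp (h2.sub h1)
    rw [sub_self, Complex.zero_re] at h3
    exact h3.congr fun k => by
      simp only [Function.comp_apply, Complex.sub_re, Complex.ofReal_re]

end Summit.QuantumFields.YangMills.Cruxes.CurvatureAmnesia.Birth

end
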